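import Literature.Computability.AlgebraicComplexity.DDS21BloatedRatioDeborder
import HarnessLib

/-!
# Dutta–Dwivedi–Saxena 2021, Def. 2.1 / Thm. 3.2: base change of the border along a field extension

Topic `Literature/Computability/AlgebraicComplexity` (cell `val-lit`, row X2-DDS21, brick "B4c (E4.6 seam)"
of the `DDS2021_thm_3_2` programme under the architecture of record (A′), lead-np RULING (143)(b):
the random point `α` of the printed proof ("`α_i` are random elements of `F`", full version p0028
L751–754) is realised as the tuple of indeterminates `y` of the field extension
`F′ = F(y) = Frac(F[y])`, the whole DiDIL/trace-back transcript is run over `F′`, and the input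
`f ∈ \overline{Σ^{[k]}Π^{[d]}Σ}` over `F` must first be read over `F′`). Source: P. Dutta, P. Dwivedi,
N. Saxena, *Demystifying the border of depth-3 algebraic circuits*, FOCS 2021
[DuttaDwivediSaxena2022], held full version `paper:galaxy-pdf-7641649743695546420`.

This file proves that Def. 2.1's approximative closure is stable under extension of the base
field: a field homomorphism `φ : F → F′` induces `F(ε) → F′(ε)` (`DDS2021.ratFuncMap φ`), maps
`Σ^{[k]}Π^{[d]}Σ` / `Σ∧Σ` circuits over `F(ε)` to circuits of the same shape over `F′(ε)`
(the tree's `isSPS_map` for `Σ^{[k]}Π^{[d]}Σ`; `mem_swsClass_map` here), preserves "`g = f + ε·Q` approximates `f`"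
(`isEpsApprox_baseChange`), hence `f ∈ \overline{𝒞}_F ⇒ φ f ∈ \overline{𝒞}_{F′}`
(`mem_border_spsClass_baseChange`, `mem_border_swsClass_baseChange`). This is the "base change
in" half of the (A′) seam; the "descent out" half (an ABP over `F(y)` computing `f ∈ F[x]` yields
one over `F`) is `AC/UABPDescent.lean`.

Honest framing: bookkeeping; `DDS2021_thm_3_2` and `DDS2021_thm_5_1` remain named facts; VP ≠ VNP
is NOT proved and nothing here bears on it.

## References

* [DuttaDwivediSaxena2022] P. Dutta, P. Dwivedi, N. Saxena, *Demystifying the border of depth-3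
  algebraic circuits*, Proc. 62nd FOCS (2021), IEEE 2022, 92–103; full version: Def. 2.1 p0016
  L416–419 ("Approximative closure of a class"), §1.1 p0006 L120–121 (`Σ^{[k]}Π^{[d]}Σ`), §2.3 p0020
  L537–540 (`Σ∧Σ`), §3 the random point `α` p0028 L751–754.
-/

noncomputable section

open MvPolynomial
open scoped BigOperators Polynomial nonZeroDivisors

namespace Literature.Computability.AlgebraicComplexity

namespace DDS2021

section RatFuncMap

variable {F F' : Type*} [Field F] [Field F'] (φ : F →+* F')

/-- The base change `F[ε] → F′(ε)`, `p ↦ p^φ`, kills no nonzero polynomial.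
[cite: DuttaDwivediSaxena2022, Def. 2.1 (full version p0016 L416–419)] -/
theorem nonZeroDivisors_le_comap_polynomial_map :
    F[X]⁰ ≤ (RatFunc F')⁰.comap ((algebraMap F'[X] (RatFunc F')).comp (Polynomial.mapRingHom φ)) := by
  intro p hp
  rw [Submonoid.mem_comap]
  apply mem_nonZeroDivisors_of_ne_zero
  rw [RingHom.comp_apply, Ne, map_eq_zero_iff _ (RatFunc.algebraMap_injective F'),
    Polynomial.coe_mapRingHom, Polynomial.map_eq_zero_iff φ.injective]
  exact nonZeroDivisors.ne_zero hp

/-- **Base change of the field of the border parameter**: a field homomorphism `φ : F → F′`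
induces `F(ε) → F′(ε)`. [cite: DuttaDwivediSaxena2022, Def. 2.1 (full version p0016 L416–419)] -/
def ratFuncMap : RatFunc F →+* RatFunc F' :=
  RatFunc.liftRingHom ((algebraMap F'[X] (RatFunc F')).comp (Polynomial.mapRingHom φ))
    (nonZeroDivisors_le_comap_polynomial_map φ)

/-- `ratFuncMap φ` extends `p ↦ p^φ` on polynomials. [cite: DuttaDwivediSaxena2022, Def. 2.1 (full version p0016 L416–419)] -/
@[simp] theorem ratFuncMap_algebraMap (p : F[X]) :
    ratFuncMap φ (algebraMap F[X] (RatFunc F) p) =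
      algebraMap F'[X] (RatFunc F') (Polynomial.map φ p) := by
  rw [ratFuncMap, RatFunc.liftRingHom_algebraMap, RingHom.comp_apply, Polynomial.coe_mapRingHom]

/-- `ratFuncMap φ ∘ (F[ε] → F(ε)) = (F′[ε] → F′(ε)) ∘ (·)^φ` as ring homomorphisms.
[cite: DuttaDwivediSaxena2022, Def. 2.1 (full version p0016 L416–419)] -/
theorem ratFuncMap_comp_algebraMap :
    (ratFuncMap φ).comp (algebraMap F[X] (RatFunc F)) =
      (algebraMap F'[X] (RatFunc F')).comp (Polynomial.mapRingHom φ) := by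
  apply RingHom.ext
  intro p
  rw [RingHom.comp_apply, RingHom.comp_apply, ratFuncMap_algebraMap, Polynomial.coe_mapRingHom]

/-- Reduction at `ε = 0` commutes with `(·)^φ`. [cite: DuttaDwivediSaxena2022, Def. 2.1 (full version p0016 L416–419)] -/
theorem constantCoeff_comp_mapRingHom :
    (Polynomial.constantCoeff : F'[X] →+* F').comp (Polynomial.mapRingHom φ) =
      φ.comp (Polynomial.constantCoeff : F[X] →+* F) := by
  ext p
  · simp
  · simp

end RatFuncMap

/-! ### Classes of circuits under a change of coefficient field -/

section Classes

variable {K K' : Type*} [Field K] [Field K'] (ψ : K →+* K') {n : ℕ}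

/-- An affine form maps to an affine form. [cite: DuttaDwivediSaxena2022, §1.1 (full version p0006 L120–121)] -/
theorem map_affineForm (a : Option (Fin n) → K) :
    map ψ (C (a none) + ∑ m : Fin n, C (a (some m)) * X m) =
      C (ψ (a none)) + ∑ m : Fin n, C (ψ (a (some m))) * X m := by
  simp [map_sum, map_C, map_X]

/-- **`Σ∧Σ` is stable under coefficient maps** (same top fan-in and exponents).
[cite: DuttaDwivediSaxena2022, §2.3 (full version p0020 L537–540)] -/
theorem mem_swsClass_map {t e : ℕ} {f : MvPolynomial (Fin n) K} (h : f ∈ swsClass K n t e) :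
    map ψ f ∈ swsClass K' n t e := by
  obtain ⟨c, α, ex, hex, rfl⟩ := h
  refine ⟨fun i => ψ (c i), fun i o => ψ (α i o), ex, hex, ?_⟩
  rw [map_sum]
  refine Finset.sum_congr rfl fun i _ => ?_
  rw [map_mul, map_C, map_pow, map_affineForm]

end Classes

/-! ### Approximation and border under base change of the field -/

section Border

variable {F F' : Type*} [Field F] [Field F'] (φ : F →+* F') {n : ℕ}

/-- **Def. 2.1 under base change**: if `g = f + ε·Q` approximates `f` over `F`, then `g^φ`
approximates `f^φ` over `F′`. [cite: DuttaDwivediSaxena2022, Def. 2.1 (full version p0016 L416–419)] -/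
theorem isEpsApprox_baseChange {f : MvPolynomial (Fin n) F} {g : MvPolynomial (Fin n) (RatFunc F)}
    (h : MS2021.IsEpsApprox f g) :
    MS2021.IsEpsApprox (map φ f) (map (ratFuncMap φ) g) := by
  obtain ⟨G, hGg, hGf⟩ := isEpsApprox_iff_exists_map.mp h
  refine isEpsApprox_iff_exists_map.mpr ⟨map (Polynomial.mapRingHom φ) G, ?_, ?_⟩
  · rw [map_map, ← ratFuncMap_comp_algebraMap, ← map_map, hGg]
  · rw [map_map, constantCoeff_comp_mapRingHom, ← map_map, hGf]

/-- **The border under base change** (general class): if every member of `𝒞` maps into `𝒞′`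
under `ratFuncMap φ`, then `\overline{𝒞} ∋ f ⇒ \overline{𝒞′} ∋ f^φ`.
[cite: DuttaDwivediSaxena2022, Def. 2.1 (full version p0016 L416–419)] -/
theorem mem_border_baseChange {𝒞 : Set (MvPolynomial (Fin n) (RatFunc F))}
    {𝒞' : Set (MvPolynomial (Fin n) (RatFunc F'))}
    (h𝒞 : ∀ g ∈ 𝒞, map (ratFuncMap φ) g ∈ 𝒞') {f : MvPolynomial (Fin n) F} (hf : f ∈ border 𝒞) :
    map φ f ∈ border 𝒞' := by
  obtain ⟨g, hg, hfg⟩ := hf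
  exact ⟨_, h𝒞 g hg, isEpsApprox_baseChange φ hfg⟩

/-- ★ **`\overline{Σ^{[k]}Π^{[d]}Σ}` under base change of the field**: the hypothesis of DDS Thm. 3.2
for `f` over `F` gives the same hypothesis for `f^φ` over `F′` (used with `F′ = F(y)`, the field of
the transcendental "random point"). [cite: DuttaDwivediSaxena2022, Def. 2.1 and §3 "α_i are random elements of F" (full version p0016 L416–419, p0028 L751–754)] -/
theorem mem_border_spsClass_baseChange {k d : ℕ} {f : MvPolynomial (Fin n) F}
    (hf : f ∈ border (spsClass (RatFunc F) n k d)) :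
    map φ f ∈ border (spsClass (RatFunc F') n k d) :=
  mem_border_baseChange φ (fun _ hg => isSPS_map (ratFuncMap φ) hg) hf

/-- `\overline{Σ∧Σ}` under base change of the field. [cite: DuttaDwivediSaxena2022, Def. 2.1 and §2.3 (full version p0016 L416–419, p0020 L537–540)] -/
theorem mem_border_swsClass_baseChange {t e : ℕ} {f : MvPolynomial (Fin n) F}
    (hf : f ∈ border (swsClass (RatFunc F) n t e)) :
    map φ f ∈ border (swsClass (RatFunc F') n t e) :=
  mem_border_baseChange φ (fun _ hg => mem_swsClass_map (ratFuncMap φ) hg) hf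

end Border

end DDS2021

end Literature.Computability.AlgebraicComplexity

end
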